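import Summits.NavierStokesRegularity.NavierStokesRegularity.Theses.LevelSetModeration
import Literature.Analysis.FluidPDE.TaoLocalisation
import Literature.Analysis.FluidPDE.NormalisedPressureDischarge

/-!
# Route LevelSetModeration — `HighSpeedPressureWork`: pressure work with the given pressure

Support file for item stmt-NavierStokesRegularity-18149; proves the registered stub
`stub_pressureWorkGivenPressure` of line `Sketch`: for a classical solution `(u, p)` of the unforced
Navier–Stokes system on `ℝ³ × [0,T)` (`ν, T > 0`) that is Leray–Hopf on `[0,T]`, every `c` and every
`t ∈ [0,T)`,

  `∫₀ᵗ∫ (1 - c/|u|)₊ ∇p̃[u(τ)]·u = ∫₀ᵗ∫ (1 - c/|u|)₊ ∇p(τ)·u`: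

by Tao's normalisation lemma (`tao_pressure_normalisation_holds`, on the closed slab `[0, (t+T)/2]`,
energy bound from the Leray–Hopf inequality) `p(τ) = p̃[u(τ)] + C(τ)` for a.e. `τ`, so the two
pressure gradients — hence the two inner integrands — agree for a.e. `τ ∈ (0, t)`.
-/

noncomputable section

-- single-conjunct summit: `Summit.<Summit>.<Problem>` repeats the name by the D-0017 layout
set_option linter.dupNamespace false

namespace Summit.NavierStokesRegularity.NavierStokesRegularity.Theorems

open MeasureTheory Set Filter Topology Function
open scoped ENNReal
open Literature.Analysis.FluidPDE

/-- **The normalised and the given pressure have the same gradient for a.e. time.** For a classical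
solution on `ℝ³ × [0,T)` (`ν > 0`) that is Leray–Hopf on `[0,T]` and `t < T`: for a.e. `τ ∈ (0, t)`,
`p τ = p̃[u τ] + C(τ)` for a measurable `C`, hence `D(p̃[u τ]) = D(p τ)` (Tao 2013, Lemma 4.1 (i),
`tao_pressure_normalisation_holds` on the closed slab `[0, (t+T)/2]`). [cite: Tao2011, Lemma 4.1 (i)] -/
theorem levelSetModeration_ae_pressure_eq_normalisedPressure {ν T : ℝ} (hν : 0 < ν)
    {u : ℝ → EuclideanSpace ℝ (Fin 3) → EuclideanSpace ℝ (Fin 3)}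
    {p : ℝ → EuclideanSpace ℝ (Fin 3) → ℝ}
    (hcl : IsClassicalNSSolutionOn (Ico 0 T) ν 0 u p) (hLH : IsLerayHopfOn T ν 0 (u 0) u)
    {t : ℝ} (ht : t ∈ Ico 0 T) :
    ∃ C : ℝ → ℝ, Measurable C ∧
      ∀ᵐ τ ∂(volume.restrict (Ioo 0 t)), (∀ x, p τ x = normalisedPressure (u τ) x + C τ) ∧
        fderiv ℝ (normalisedPressure (u τ)) = fderiv ℝ (p τ) := by
  set T' : ℝ := (t + T) / 2 with hT'
  have hT'pos : 0 < T' := by rw [hT']; linarith [ht.1, ht.2]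
  have htT' : t < T' := by rw [hT']; linarith [ht.2]
  have hT'T : T' < T := by rw [hT']; linarith [ht.2]
  have hcl' : IsClassicalNSSolutionOn (Icc 0 T') ν 0 u p :=
    hcl.mono (Icc_subset_Ico_right hT'T) (uniqueDiffOn_Icc hT'pos)
  have hEn : ∃ C : ℝ≥0∞, C < ⊤ ∧ ∀ τ ∈ Icc 0 T', ∫⁻ x, ‖u τ x‖ₑ ^ 2 ≤ C :=
    ⟨ENNReal.ofReal (2 * VectorCalculus.kineticEnergy (u 0)), ENNReal.ofReal_lt_top, fun τ hτ =>
      hLH.lintegral_enorm_sq_le hν.le ⟨hτ.1, hτ.2.trans hT'T.le⟩⟩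
  obtain ⟨C, hCmeas, -, hnorm⟩ := tao_pressure_normalisation_holds ν T' hν hT'pos u p hcl' hEn
  have hsub : Ioo 0 t ⊆ Icc 0 T' := fun τ hτ => ⟨hτ.1.le, hτ.2.le.trans htT'.le⟩
  refine ⟨C, hCmeas, ?_⟩
  filter_upwards [ae_restrict_of_ae_restrict_of_subset hsub hnorm] with τ hτ
  refine ⟨hτ, ?_⟩
  have hfun : normalisedPressure (u τ) = fun x => p τ x - C τ := by
    funext x
    have := hτ x
    linarith
  rw [hfun]
  funext x
  exact fderiv_sub_const (C τ)

/-- **Pressure work with the given pressure** (registered stub `stub_pressureWorkGivenPressure` of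
the crux item stmt-NavierStokesRegularity-18149, line `Sketch`): for a classical solution `(u, p)` on
`ℝ³ × [0,T)` (`ν, T > 0`) that is Leray–Hopf on `[0,T]`, every level `c` and every `t ∈ [0,T)`, the
pressure-work pairing computed with the normalised pressure `p̃[u(τ)]` equals the one computed with
the given pressure `p(τ)` (the inner integrands agree for a.e. `τ ∈ (0,t)`).
[cite: Tao2011, Lemma 4.1 (i)] -/
theorem stub_pressureWorkGivenPressure :
    ∀ (ν T : ℝ) (u : ℝ → EuclideanSpace ℝ (Fin 3) → EuclideanSpace ℝ (Fin 3)) (p : ℝ → EuclideanSpace ℝ (Fin 3) → ℝ), 0 < ν → 0 < T → Literature.Analysis.FluidPDE.IsClassicalNSSolutionOn (Set.Ico 0 T) ν 0 u p → Literature.Analysis.FluidPDE.IsLerayHopfOn T ν 0 (u 0) u → ∀ (c t : ℝ), t ∈ Set.Ico 0 T → (∫ τ in Set.Ioo 0 t, ∫ x, max (1 - c / ‖u τ x‖) 0 * (fderiv ℝ (Literature.Analysis.FluidPDE.normalisedPressure (u τ)) x (u τ x))) = ∫ τ in Set.Ioo 0 t, ∫ x, max (1 - c / ‖u τ x‖)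 0 * (fderiv ℝ (p τ) x (u τ x)) := by
  intro ν T u p hν _hT hcl hLH c t ht
  obtain ⟨C, -, hae⟩ := levelSetModeration_ae_pressure_eq_normalisedPressure hν hcl hLH ht
  refine integral_congr_ae ?_
  filter_upwards [hae] with τ hτ
  simp only [hτ.2]

end Summit.NavierStokesRegularity.NavierStokesRegularity.Theorems
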